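import Summits.QuantumFields.YangMills.Theorems.DiagonalMirrorRPRTwoShiftExtractionTsum

/-!
# Crux `WeakCouplingHypercubicLimitRP` (stmt-QuantumFields-27398), door B, R1-side, sandwich side item (iv-b):
# NORMALISATION — from the two-insertion `HasSum` identities in the EIGEN currency to the `signal` inequality

Helper file (`--supports stmt-QuantumFields-27398 --as helper`) of hand `hand-10604-wilsonDiagModel-3` g0, docket director-ym g24
**O4 WORD 47 (1)/(3), WORD 48 (4)(F2)** (the sandwich side of the pinned two-shift probe; target of record
`twoShiftProbesAt r sch hβ P hc : TwoShiftProbes (wilsonDiagonalTransferModel r sch hβ)`).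

Item (ii) (hand-2 g3) delivers, at a step `k` with eigen-package `(κᵢ)`, top modulus `top`, partition function `Z = Tr K_u^{side} > 0`
and the pinned probe's non-negative summable two-index weights `w(a,b)` (`= ⟪ψ_a, 𝒲 ψ_b⟫⟪ψ_b, 𝒲ᵀ ψ_a⟫ ≥ 0`, Hilbert–Schmidt), the two
identities (✓`Literature…hasSum_integral_iterate_insert_two` + its YM reading)

  `HasSum (p ↦ w p.1 p.2 · κ_{p.2}^{2m} · κ_{p.1}^{N−2m−2d}) (Z · P_m)`,  `m = n, 2n`,

`P_m` the swap-paired expectation at diagonal shift `m` (the lead's `swapShiftPairing`), `N, d` free naturals with `4n + 2d ≤ N` (parity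
and offsets are (ii)'s choice; only `p = N − 6n − 2d ≥ 3·side/8` binds downstream).  This file is the CONVENTION-FREE real analysis
that turns them into the `signal` field of `TwoShiftProbes`, with every quantity an explicit formula:

* `signedRatio_pow_mul_eq` — the term identity `(|y|/top)^{2m} (σ(x)|x|/top)^{L} = y^{2m} x^{L} / top^{2m+L}` (`σ(x) = ±1` the sign);
* `hasSum_normalised_twoShiftFamily` — the identity above, divided by `Z`, IS `HasSum` of §1's shifted-sandwich family for
  `ω := (top^{N−2d}/Z) · w`, `x := |κ|/top`, `σ := sign κ`, with sum `P_m`;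
* ★★ `signal_of_twoShift_hasSum` — with the vacuum index `o` (`κ_o = top`, the LANDED `exists_even_top` / `exists_vacuumEig`) and
  `r ≥ 0` dominating every non-vacuum modulus (`|κ_a| ≤ r·top`, `a ≠ o`; the model's `slowRatio`):
  `(top^{N−2d}/Z) · (Σ'_{b ∈ Slow} w(o,b)) · (r^{2n} − r^{4n}) ≤ (P_n − P_{2n}) + 2 · ((top^{N−2d}/Z) · Σ'_{p.1 ≠ o} w p) · r^{N−4n−2d}`,
  `Slow = {b ≠ o : |κ_b| = r·top}` the slowest eigenspace — i.e. `vis · (r^{2n} − r^{4n}) ≤ budget + 2 W r^{p} r^{2n}` with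
  `vis := (top^{N−2d}/Z) Σ'_{b∈Slow} w(o,b)` (`∝ ‖P_{Slow} 𝒲 ψ_vac‖²`), `W := (top^{N−2d}/Z) Σ'_{a≠o} Σ_b w(a,b)`, `budget ≥ P_n − P_{2n}`
  (✓`twoShift_signal_le_tsum` on the top row, then `Summable.tsum_subtype_le` onto the slowest eigenspace where `x_b = r`).

HONEST FRAMING: real analysis on summable families; the coupling positivity `0 < Σ'_{b∈Slow} w(o,b)` is NOT proved (it is the displayed
letter `SlowCoupled` of WORD 48 (4), physics of the probe); nothing about Wilson's measure, K1/K2/R1/R2, D1′, ⟨27398⟩, S6i or the summit is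
proved; the Yang–Mills mass gap is NOT proved here or anywhere in the tree.  No definition, no instance, no notation.
-/

open Filter Topology

namespace Summit.QuantumFields.YangMills.Cruxes.DiagonalMirrorRPR.SignTwistedDiagonalTrace

section Normalisation

variable {ι : Type*}

/-- The sign `σ(x) ∈ {1, −1}` used to split an eigenvalue into modulus and sign satisfies `σ(x) · |x| = x`. -/
theorem ite_sign_mul_abs_eq (x : ℝ) : (if 0 ≤ x then (1 : ℝ) else -1) * |x| = x := by
  split_ifs with h
  · rw [one_mul, abs_of_nonneg h]
  · rw [abs_of_neg (not_le.1 h)]; ring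

/-- **Term identity of the normalisation**: `(|y|/top)^{2m} · (σ(x) · (|x|/top))^{L} = y^{2m} · x^{L} / top^{2m+L}`. -/
theorem signedRatio_pow_mul_eq (x y top : ℝ) (m L : ℕ) :
    (|y| / top) ^ (2 * m) * ((if 0 ≤ x then (1 : ℝ) else -1) * (|x| / top)) ^ L = y ^ (2 * m) * x ^ L / top ^ (2 * m + L) := by
  have h1 : (if 0 ≤ x then (1 : ℝ) else -1) * (|x| / top) = x / top := by
    rw [← mul_div_assoc, ite_sign_mul_abs_eq]
  have h2 : (|y| / top) ^ (2 * m) = y ^ (2 * m) / top ^ (2 * m) := by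
    rw [div_pow, Even.pow_abs ⟨m, two_mul m⟩]
  rw [h1, h2, div_pow, pow_add, div_mul_div_comm]

/-- **The normalised identity.**  From `HasSum (p ↦ w p.1 p.2 · κ_{p.2}^{2m} · κ_{p.1}^{N−2m−2d}) (Z · P)` (`Z ≠ 0`, `2m + 2d ≤ N`):
§1's shifted-sandwich family for `ω := (top^{N−2d}/Z) · w`, `x := |κ|/top`, `σ := sign κ` has sum `P` (`top ≠ 0`). -/
theorem hasSum_normalised_twoShiftFamily (κ : ι → ℝ) (w : ι → ι → ℝ) {top Z P : ℝ} (htop : top ≠ 0) (hZ : Z ≠ 0)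
    (N d m : ℕ) (hm : 2 * m + 2 * d ≤ N)
    (h : HasSum (fun p : ι × ι => w p.1 p.2 * (κ p.2 ^ (2 * m) * κ p.1 ^ (N - 2 * m - 2 * d))) (Z * P)) :
    HasSum (fun p : ι × ι => top ^ (N - 2 * d) / Z * w p.1 p.2 *
      ((|κ p.2| / top) ^ (2 * m) * ((if 0 ≤ κ p.1 then (1 : ℝ) else -1) * (|κ p.1| / top)) ^ (N - 2 * m - 2 * d))) P := by
  have hT : 2 * m + (N - 2 * m - 2 * d) = N - 2 * d := by omega
  have e : (fun p : ι × ι => top ^ (N - 2 * d) / Z * w p.1 p.2 *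
      ((|κ p.2| / top) ^ (2 * m) * ((if 0 ≤ κ p.1 then (1 : ℝ) else -1) * (|κ p.1| / top)) ^ (N - 2 * m - 2 * d))) =
      fun p : ι × ι => Z⁻¹ * (w p.1 p.2 * (κ p.2 ^ (2 * m) * κ p.1 ^ (N - 2 * m - 2 * d))) := by
    funext p
    rw [signedRatio_pow_mul_eq, hT]
    have htp : top ^ (N - 2 * d) ≠ 0 := pow_ne_zero _ htop
    field_simp
  rw [e, show P = Z⁻¹ * (Z * P) by field_simp]
  exact h.mul_left _

/-- ★★ **The `signal` inequality from the two-insertion identities (normalisation + top-row separation).**  `κ` the eigenvalues with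
moduli `≤ top`, `o` a vacuum index (`κ_o = top > 0`), `w ≥ 0` summable two-index weights, `Z > 0`, `4n + 2d ≤ N`, the two identities at
the shifts `n, 2n` with sums `Z · P₁`, `Z · P₂`, and `r ≥ 0` dominating every non-vacuum modulus.  Then, with `Slow = {b ≠ o : |κ_b| = r·top}`,
`(top^{N−2d}/Z) (Σ'_{b∈Slow} w(o,b)) (r^{2n} − r^{4n}) ≤ (P₁ − P₂) + 2 ((top^{N−2d}/Z) Σ'_{p.1≠o} w p) r^{N−4n−2d}`. -/
theorem signal_of_twoShift_hasSum (κ : ι → ℝ) {top : ℝ} (htop : 0 < top) (hκ : ∀ i, |κ i| ≤ top) (o : ι) (ho : κ o = top)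
    (w : ι → ι → ℝ) (hw : ∀ a b, 0 ≤ w a b) (hws : Summable fun p : ι × ι => w p.1 p.2) {Z : ℝ} (hZ : 0 < Z)
    (N d n : ℕ) (hN : 4 * n + 2 * d ≤ N) {P₁ P₂ : ℝ}
    (h₁ : HasSum (fun p : ι × ι => w p.1 p.2 * (κ p.2 ^ (2 * n) * κ p.1 ^ (N - 2 * n - 2 * d))) (Z * P₁))
    (h₂ : HasSum (fun p : ι × ι => w p.1 p.2 * (κ p.2 ^ (2 * (2 * n)) * κ p.1 ^ (N - 2 * (2 * n) - 2 * d))) (Z * P₂))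
    {r : ℝ} (hr0 : 0 ≤ r) (hr : ∀ a, a ≠ o → |κ a| ≤ r * top) :
    top ^ (N - 2 * d) / Z * (∑' b : {b : ι | b ≠ o ∧ |κ b| = r * top}, w o b) * (r ^ (2 * n) - r ^ (4 * n)) ≤
      (P₁ - P₂) + 2 * (top ^ (N - 2 * d) / Z * ∑' p : {p : ι × ι | p.1 ≠ o}, w p.1.1 p.1.2) * r ^ (N - 4 * n - 2 * d) := by
  -- §1 data
  set C : ℝ := top ^ (N - 2 * d) / Z with hC
  have hC0 : 0 ≤ C := div_nonneg (pow_nonneg htop.le _) hZ.le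
  set ω : ι → ι → ℝ := fun a b => C * w a b with hω
  set x : ι → ℝ := fun i => |κ i| / top with hx
  set σ : ι → ℝ := fun i => if 0 ≤ κ i then (1 : ℝ) else -1 with hσ
  have hω0 : ∀ a b, 0 ≤ ω a b := fun a b => mul_nonneg hC0 (hw a b)
  have hx0 : ∀ a, 0 ≤ x a := fun a => div_nonneg (abs_nonneg _) htop.le
  have hx1 : ∀ a, x a ≤ 1 := fun a => (div_le_one htop).2 (hκ a)
  have hσ1 : ∀ a, σ a = 1 ∨ σ a = -1 := fun a => by
    simp only [hσ]; split_ifs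
    · exact Or.inl rfl
    · exact Or.inr rfl
  have hxo : x o = 1 := by simp only [hx, ho, abs_of_pos htop, div_self htop.ne']
  have hσo : σ o = 1 := by simp only [hσ, ho, if_pos htop.le]
  have hωs : Summable fun p : ι × ι => ω p.1 p.2 := hws.mul_left C
  have hxr : ∀ a, a ≠ o → x a ≤ r := fun a ha => by
    simp only [hx]
    rw [div_le_iff₀ htop]
    exact hr a ha
  -- the two normalised identities
  have h₁' : HasSum (fun p : ι × ι => ω p.1 p.2 * (x p.2 ^ (2 * n) * (σ p.1 * x p.1) ^ (N - 2 * n - 2 * d))) P₁ :=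
    hasSum_normalised_twoShiftFamily κ w htop.ne' hZ.ne' N d n (by omega) h₁
  have h₂' : HasSum (fun p : ι × ι =>
      ω p.1 p.2 * (x p.2 ^ (2 * (2 * n)) * (σ p.1 * x p.1) ^ (N - 2 * (2 * n) - 2 * d))) P₂ :=
    hasSum_normalised_twoShiftFamily κ w htop.ne' hZ.ne' N d (2 * n) (by omega) h₂
  -- the off-top weight
  have hW : ∑' p : {p : ι × ι | p.1 ≠ o}, ω p.1.1 p.1.2 ≤ C * ∑' p : {p : ι × ι | p.1 ≠ o}, w p.1.1 p.1.2 := by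
    rw [← tsum_mul_left]
  -- the top row is summable; its sum obeys the two-shift bound
  have hterm0 : ∀ c, 0 ≤ ω o c * (x c ^ (2 * n) - x c ^ (4 * n)) := fun c =>
    mul_nonneg (hω0 o c) (sub_nonneg.2 (pow_le_pow_of_le_one (hx0 c) (hx1 c) (by omega)))
  have hrow : Summable fun c => ω o c * (x c ^ (2 * n) - x c ^ (4 * n)) := by
    have hωo : Summable fun c => ω o c := hωs.prod_factor o
    refine Summable.of_norm_bounded hωo fun c => ?_
    rw [Real.norm_eq_abs, abs_of_nonneg (hterm0 c)]
    have h1 : x c ^ (2 * n) - x c ^ (4 * n) ≤ 1 := by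
      linarith [pow_le_one₀ (n := 2 * n) (hx0 c) (hx1 c), pow_nonneg (hx0 c) (4 * n)]
    exact mul_le_of_le_one_right (hω0 o c) h1
  have hmain := twoShift_signal_le_tsum ω x σ o N d n hω0 hx0 hx1 hσ1 hxo hσo hN hωs h₁' h₂' hr0 hxr hW hrow.hasSum
  -- restrict the top row to the slowest eigenspace, where `x_b = r`
  have hsub : ∑' b : {b : ι | b ≠ o ∧ |κ b| = r * top}, ω o b * (x b ^ (2 * n) - x b ^ (4 * n)) ≤
      ∑' c, ω o c * (x c ^ (2 * n) - x c ^ (4 * n)) :=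
    hrow.tsum_subtype_le (fun c => ω o c * (x c ^ (2 * n) - x c ^ (4 * n))) _ hterm0
  have hslow : ∑' b : {b : ι | b ≠ o ∧ |κ b| = r * top}, ω o b * (x b ^ (2 * n) - x b ^ (4 * n)) =
      C * (∑' b : {b : ι | b ≠ o ∧ |κ b| = r * top}, w o b) * (r ^ (2 * n) - r ^ (4 * n)) := by
    have e : (fun b : {b : ι | b ≠ o ∧ |κ b| = r * top} => ω o b * (x b ^ (2 * n) - x b ^ (4 * n))) =
        fun b : {b : ι | b ≠ o ∧ |κ b| = r * top} => (C * (r ^ (2 * n) - r ^ (4 * n))) * w o b := by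
      funext b
      have hb : x b = r := by
        have := b.2.2
        simp only [hx]
        rw [this, mul_div_assoc, div_self htop.ne', mul_one]
      simp only [hω]
      rw [hb]
      ring
    rw [e, tsum_mul_left]
    ring
  rw [hslow] at hsub
  linarith

end Normalisation

end Summit.QuantumFields.YangMills.Cruxes.DiagonalMirrorRPR.SignTwistedDiagonalTrace
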